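import Mathlib
import Literature.Analysis.Complex.CrossTheoremNStrips
import Summits.QuantumFields.YangMills.Theorems.F4SubCurvatureDoorPlanarConicChart
import HarnessLib

/-!
# Rung R1 «PlanarAnalyticOffZero» of LINE g20-A «angular type» BY NAME (planner ym-idea-3 g20, crux ⟨stmt-QuantumFields-23035⟩
# `F4SubCurvatureDoor.ShortRootRigidity`; owner file `Cruxes/ShortRootRigidity/Lines/angular_type_rungs.lean`)

Free-hands work of the LEAD seat ym-line-sfw-p2 (gen 74).  Every kernel of the hexagonal planar class is real-analytic off
the origin: at `y ≠ 0` rung R1⁺ `planarConicChart` (file `…PlanarConicChart`) gives a function `F` holomorphic on the complex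
polydisc of radius `c‖y‖` around `y` whose real trace is `k`; the tree's chart lemma
`Literature.Analysis.Complex.analyticAt_of_holomorphic_chart_fintype` (Osgood + restriction of scalars + the real-analytic
affine chart), with the standard basis of `ℝ²` and `G(z) := F(y₀ + z₀, y₁ + z₁)`, gives analyticity of `k` at `y`.  Also the
«restore-first structure» named in LINE g19-A §P1.

The Prop `PlanarAnalyticOffZero` is restated CHARACTER-FOR-CHARACTER from the owner file (same namespace).
HONEST LABEL: a budget-free rung (R1, size S given R1⁺) of an OPEN line; (C) `PlanarSpectralCone`, (A), the crux, every
rung of LADDER-YM and every summit are untouched; the Yang–Mills mass gap is NOT proved by this.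
-/

noncomputable section

namespace Summit.QuantumFields.YangMills.Cruxes.ShortRootRigidity.AngularTypeRungs

open scoped Topology InnerProductSpace BigOperators
open Set Metric
open Literature.Analysis.Complex (analyticAt_of_holomorphic_chart_fintype)
open Summit.QuantumFields.YangMills.Theorems.F4SubCurvatureDoorSliceDensityRegistered (E2)
open Summit.QuantumFields.YangMills.Theorems.F4SubCurvatureDoorSliceInClassRegistered (InPlanarClass)

/-- **R1 · PlanarAnalyticOffZero** (target, S given R1⁺; budget-free).  Every kernel of the hexagonal planar class is
real-analytic off the origin.  (From R1⁺ by a two-variable chart lemma in the manner of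
`Literature.Analysis.Complex.analyticAt_of_holomorphic_chart`.)  Also the «restore-first structure» of LINE g19-A §P1.
[target; sources: JarnickiPflug2011 Ch. 5; OsterwalderSchrader1975] -/
def PlanarAnalyticOffZero : Prop :=
  ∀ k : E2 → ℝ, InPlanarClass k → AnalyticOnNhd ℝ k {y : E2 | y ≠ 0}

/-- The affine real chart at `y` in the standard basis lands on `mk2`. -/
theorem add_sum_smul_basisFun (y : E2) (t : Fin 2 → ℝ) :
    y + ∑ i, t i • (EuclideanSpace.basisFun (Fin 2) ℝ).toBasis i = mk2 (y 0 + t 0) (y 1 + t 1) := by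
  rw [Fin.sum_univ_two, OrthonormalBasis.coe_toBasis, EuclideanSpace.basisFun_apply, EuclideanSpace.basisFun_apply]
  ext i
  fin_cases i <;> simp [mk2]

/-- **R1 · PlanarAnalyticOffZero holds** (from R1⁺ `planarConicChart` by the chart lemma
`analyticAt_of_holomorphic_chart_fintype` in the standard basis). -/
theorem planarAnalyticOffZero : PlanarAnalyticOffZero := by
  intro k hk y hy
  have hy' : y ≠ 0 := hy
  have hy0 : 0 < ‖y‖ := norm_pos_iff.mpr hy'
  obtain ⟨c, hc, hchart⟩ := planarConicChart k hk
  obtain ⟨F, hFd, hFr, -⟩ := hchart y hy'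
  have hr : 0 < c * ‖y‖ := mul_pos hc hy0
  have hA : Differentiable ℂ (fun z : Fin 2 → ℂ => ((((y 0 : ℝ) : ℂ) + z 0, ((y 1 : ℝ) : ℂ) + z 1) : ℂ × ℂ)) := by
    fun_prop
  have hmaps : MapsTo (fun z : Fin 2 → ℂ => ((((y 0 : ℝ) : ℂ) + z 0, ((y 1 : ℝ) : ℂ) + z 1) : ℂ × ℂ))
      {z : Fin 2 → ℂ | ∀ i, ‖z i‖ < c * ‖y‖}
      (ball ((((y 0 : ℝ) : ℂ), ((y 1 : ℝ) : ℂ)) : ℂ × ℂ) (c * ‖y‖)) := by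
    intro z hz
    rw [mem_ball, Prod.dist_eq, max_lt_iff]
    constructor
    · show dist (((y 0 : ℝ) : ℂ) + z 0) ((y 0 : ℝ) : ℂ) < _
      rw [dist_eq_norm, add_sub_cancel_left]
      exact hz 0
    · show dist (((y 1 : ℝ) : ℂ) + z 1) ((y 1 : ℝ) : ℂ) < _
      rw [dist_eq_norm, add_sub_cancel_left]
      exact hz 1
  refine analyticAt_of_holomorphic_chart_fintype (EuclideanSpace.basisFun (Fin 2) ℝ).toBasis hr
    (G := fun z : Fin 2 → ℂ => F ((((y 0 : ℝ) : ℂ) + z 0, ((y 1 : ℝ) : ℂ) + z 1) : ℂ × ℂ))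
    (hFd.comp hA.differentiableOn hmaps) (fun t ht => ?_)
  show F ((((y 0 : ℝ) : ℂ) + (t 0 : ℂ), ((y 1 : ℝ) : ℂ) + (t 1 : ℂ)) : ℂ × ℂ) = _
  rw [add_sum_smul_basisFun, ← Complex.ofReal_add, ← Complex.ofReal_add,
    hFr (y 0 + t 0) (y 1 + t 1) (by rw [add_sub_cancel_left]; exact ht 0)
      (by rw [add_sub_cancel_left]; exact ht 1)]

end Summit.QuantumFields.YangMills.Cruxes.ShortRootRigidity.AngularTypeRungs

end
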